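import Summits.BirchSwinnertonDyer.Rank1Residual.X11b.CWFrameValueRigidity
import Summits.BirchSwinnertonDyer.Rank1Residual.X11b.RouteR1BDPExists
import Summits.BirchSwinnertonDyer.Rank1Residual.X11b.HalvesReceptacle
import Literature.NumberTheory.EllipticCurves.Castella2018.PAdicWaldspurgerFormula
import Literature.NumberTheory.EllipticCurves.CastellaGrossiSkinner2025.GreenbergAnticyclotomicMainConjectureProofs
import Literature.NumberTheory.EllipticCurves.PAdicGrossZagierConstantTermProofs
import Literature.NumberTheory.EllipticCurves.LFunctionPrimeCoeff
import Literature.FieldTheory.AlgClosed.PadicAlgClEquivComplex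
import HarnessLib

set_option autoImplicit false

/-!
# Castella–Wan 2024 Thm. 5.3 ∘ Castella 2018 Thm. 3.2 AT THE TRIVIAL CHARACTER — the composite of
# seat p3 (`castellaWan2024_thm53_castella2018_thm32_constantCoeff`) DERIVED, on its supersingular
# slice, from the two single-source named facts and the frame-rigidity theorem (no identification)

Cell `pub/bsd-print-x6` (D-0131 (2) PRINT tier, leaf `ClassX6 ∧ r_an = 0`), literature typer ty1
(gen 2). Completes the cell referee's PRE-AUDIT PA-10 (c) recommendation (HOME REFEREE.md §2,
2026-08-27T15:55Z: "restate the composite as a PROVED theorem from PA-8's fact p540971 + A207 + that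
glue") with the glue PROVED (`X11b/CWFrameValueRigidity.lean`, p547864) instead of assumed. THEOREMS ONLY
(no definition, no named fact, no `sorry`); nothing about any curve is asserted; PARTITION: 0 cells move.

## The statement (§2 `exists_constantCoeff_eq_mul_sq_of_thm53_of_thm32`)

Hypotheses = the binder list of the composite
`Literature.NumberTheory.EllipticCurves.castellaWan2024_thm53_castella2018_thm32_constantCoeff`
(p543331) with THREE differences, each forced by the letter of the two single-source facts:
(a) `GoodSS W p` in place of `Good W p` — Castella–Wan's Thm. 5.3 is TYPED at good SUPERSINGULAR `p`
    (`CastellaWan2024.thm53_exists_isCWBDPLFunction_charIdeal_map_le`, restriction (R1) of that file;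
    print covers every good `p ≥ 5`); this is the slice every X6 consumer uses;
(b) the parametrisation datum at level `N_E = W.conductorNorm ℤ` (as in p3's own consumers
    `…PrintX6AnticyclotomicCW53Composite` §3 and in Castella 2018 Thm. 3.2's fact);
(c) the Heegner point read through `w.embedding` for an infinite place `w` of `K` — the letter of
    `Castella2018.thm32_exists_isBDPLFunction_valueAtOne` — instead of an arbitrary `ι_ℂ : K →+* ℂ`
    (for the unique infinite place of an imaginary quadratic `K`, `w.embedding` is one of the two complex
    embeddings; Cai–Shu–Tian's supply `exists_map_eq_heegnerPointComplex_of_heegnerCondition` serves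
    every embedding, so consumers lose nothing).
Conclusion = the composite's, verbatim: for every generator `F` of `ch_Λ(X_ac)` (strict at `v̄`),
`∃ e ∈ ℤ_p, F(0) = e · ((1 − a_p p⁻¹ + p⁻¹) · log_{ω_E} P)²` with `log` read along `ι : K →+* ℚ_p`
inducing `v` (`padicLogOmega W p ι P`, by `rfl` the composite's `padicLogPoint (m₀ • P_ι)/m₀`).

## Proof (§2)

1. `p ∈ v` (`‖ι(p)‖ = p⁻¹ < 1`); an embedding datum `ι' : ℚ̄_p ≃ ℂ` inducing `v`
   (`PadicAlgCl.nonempty_ringEquiv_complex` + `X11b.exists_datum_forall_mem_iff`, Steinitz + Galois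
   transitivity on the primes above `p`).
2. PA-8's fact (CW24 Prop. 2.1 ∧ Thm. 5.3) at `(ι', v, v̄, κ, γ, f_E)`: a frame `(Ω_K, Ω_p, L_W)` with
   `IsCWBDPLFunction ι' v κ γ f_E d_K Ω_K Ω_p L_W` and `ch_Λ(X_ac)·R₀⟦T⟧ ⊆ (L_W)` along every structure map
   `j : ℤ_p → R₀` (one exists: `exists_ringHom_padicInt_unrIntegers`).
3. Cas18 Thm. 3.1 ∧ 3.2's fact at `(ι', v, κ, γ, Dt, H, w, ι, P)`: a frame `(Ω_K', Ω_p', L_C)` with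
   `IsBDPLFunction ι' v κ γ f_E Ω_K' Ω_p' L_C` and `L_C(𝟙) = u · V̂²`, `u ∈ R₀ˣ`, `V̂ = V` read in `ℂ_p`,
   `V = (1 − a_p p⁻¹ + p⁻¹)·log_{ω_E} P ∈ ℚ_p`.
4. Frame rigidity across the two normalisations (`X11b.norm_coe_constantCoeff_eq_of_isCWBDPLFunction_of_isBDPLFunction`,
   p547864; `p ∤ N_E` by good reduction, `p ∤ d_K` by `p` split): `‖L_W(𝟙)‖ = ‖L_C(𝟙)‖ = ‖V‖²`.
5. `j(F) = g·L_W` ⟹ `‖F(0)‖_p = ‖g(0)‖·‖L_W(𝟙)‖ ≤ ‖V‖²` (`R₀ ⊂` closed unit ball), so `e := F(0)/V² ∈ ℤ_p`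
   (and `e := 0` if `V = 0`).
`a_p`: Castella's `W.LFunction p` = the composite's `W.frobeniusTrace p` at a good prime
(`LFunction_apply_prime_eq_frobeniusTrace`).

## What this buys road (E)

The PLAN v3.2 pack conjunct (1) `castellaWan2024_thm53_castella2018_thm32_constantCoeff` (flags
composite / `CW24-Cas18-LBDP-identification@CH18`) can be replaced by the two page-audited
single-source facts `CastellaWan2024.thm53_…` (PA-8; flags CW24-CLW22-addendum, Hid04-gap) and
`Castella2018.thm32_…` (A206/A207); the identification flag leaves the Err child's chain. HONEST
FRAMING: bookkeeping over landed facts and theorems; the remaining flags are untouched; not a step of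
BSD by itself.

References: [CastellaWan2023] Thm. 5.3, Prop. 2.1 (MS pp. 5–8, 23–25); [Castella2018] Thm. 3.1–3.2
(arXiv:1704.06608 p. 9); [CastellaHsieh2018] §3.3.
-/

noncomputable section

open scoped Classical Topology

open Filter PowerSeries NumberField IsDedekindDomain Field WeierstrassCurve
  Literature.NumberTheory.EllipticCurves Literature.NumberTheory.GaloisRepresentations
  Literature.NumberTheory.EllipticCurves.ModularForms
  Literature.NumberTheory.EllipticCurves.Rank1Residual
  Literature.NumberTheory.EllipticCurves.CastellaWan2024
  Literature.NumberTheory.EllipticCurves.Castella2018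

namespace Summit.BirchSwinnertonDyer.Rank1Residual.X11b

variable {p : ℕ} [Fact p.Prime] {W : WeierstrassCurve ℚ} [W.IsElliptic] [W.IsGloballyMinimal]
  [NeZero (W.conductorNorm ℤ)] {K : Type} [Field K] [NumberField K]

/-! ### §1 Two small readings -/

omit [NumberField K] in
/-- `p` lies in the prime of `K` cut out by an embedding `ι : K → ℚ_p` (`‖ι(p)‖ = ‖p‖_p < 1`).
[folklore] -/
theorem natCast_mem_of_forall_mem_iff_norm_lt (ι : K →+* ℚ_[p]) (v : HeightOneSpectrum (𝓞 K))
    (hv : ∀ x : 𝓞 K, x ∈ v.asIdeal ↔ ‖ι (x : K)‖ < 1) : ((p : ℕ) : 𝓞 K) ∈ v.asIdeal := by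
  rw [hv]
  have h : ι (((p : ℕ) : 𝓞 K) : K) = (p : ℚ_[p]) := by simp
  rw [h]
  exact Padic.norm_p_lt_one

/-- A `p`-adic number of norm at most `‖V‖²` is `e · V²` for some `e ∈ ℤ_p`. [folklore] -/
theorem exists_padicInt_mul_sq_of_norm_le {x V : ℚ_[p]} (h : ‖x‖ ≤ ‖V‖ ^ 2) :
    ∃ e : ℤ_[p], x = (e : ℚ_[p]) * V ^ 2 := by
  by_cases hV : V = 0
  · refine ⟨0, ?_⟩
    rw [hV, norm_zero, zero_pow two_ne_zero] at h
    rw [norm_le_zero_iff.mp h, PadicInt.coe_zero, zero_mul]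
  · have hV2 : V ^ 2 ≠ 0 := pow_ne_zero _ hV
    refine ⟨⟨x / V ^ 2, ?_⟩, ?_⟩
    · rw [norm_div, norm_pow]
      exact div_le_one_of_le₀ h (by positivity)
    · show x = x / V ^ 2 * V ^ 2
      rw [div_mul_cancel₀ _ hV2]

/-! ### §2 The composite at the trivial character, DERIVED (supersingular slice, level `N_E`,
Castella's embedding letter) -/

/-- **Castella–Wan 2024 Thm. 5.3 ∘ Castella 2018 Thm. 3.2 at the trivial character, FROM THE TWO
SINGLE-SOURCE FACTS** (no identification of `p`-adic `L`-functions): for `W/ℚ` globally minimal,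
`p ≥ 5` good SUPERSINGULAR, `E` semistable with `ρ̄_{E,p}` irreducible; `K` imaginary quadratic with
every prime of `N_E` split or ramified, some prime of `N_E` non-split, `2` split if `N_E` is odd, `p`
split; `ι : K → ℚ_p` inducing the prime `v`, `v̄ ∋ p` the other prime; `κ` anticyclotomic with
generator `γ`; a parametrisation datum `Dt` at level `N_E` with `p ∤ c`, a Heegner datum `H` of
discriminant `d_K`, an infinite place `w` and `P ∈ E(K)` with `P.map w.embedding = heegnerPointComplex Dt H`:
EVERY generator `F` of `ch_Λ(X_ac)` (`AcSelmer.XAc … v̄ ∅ γ`: strict at `v̄`, relaxed at `v`) satisfies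
`F(0) = e · ((1 − a_p p⁻¹ + p⁻¹) · log_{ω_E} P)²` for some `e ∈ ℤ_p`, `log` along `ι`.
Inputs BY NAME: `CastellaWan2024.thm53_exists_isCWBDPLFunction_charIdeal_map_le` (PA-8),
`Castella2018.thm32_exists_isBDPLFunction_valueAtOne` (A206/A207), and the frame rigidity
`X11b.norm_coe_constantCoeff_eq_of_isCWBDPLFunction_of_isBDPLFunction` (p547864).
[cite: CastellaWan2023, Thm. 5.3 (MS pp. 23–25) and Prop. 2.1 (MS p. 6)]
[cite: Castella2018, Thm. 3.1–3.2 (arXiv:1704.06608 p. 9)] -/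
theorem exists_constantCoeff_eq_mul_sq_of_thm53_of_thm32
    (h53 : thm53_exists_isCWBDPLFunction_charIdeal_map_le)
    (h32 : thm32_exists_isBDPLFunction_valueAtOne)
    (hp : 5 ≤ p) (hss : GoodSS W p) (hsst : Semistable W) (hirr : Irr W p)
    (hK : IsImaginaryQuadratic K)
    (hHeeg : ∀ ℓ : ℕ, ℓ.Prime → ℓ ∣ W.conductorNorm ℤ →
      ∃ v : HeightOneSpectrum (𝓞 K), Ideal.absNorm v.asIdeal = ℓ)
    (hii : ∃ ℓ : ℕ, ℓ.Prime ∧ ℓ ∣ W.conductorNorm ℤ ∧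
      ((Ideal.span {(ℓ : ℤ)}).primesOver (𝓞 K)).ncard ≠ 2)
    (hiii : ¬ 2 ∣ W.conductorNorm ℤ → ((Ideal.span {(2 : ℤ)}).primesOver (𝓞 K)).ncard = 2)
    (hHp : SatisfiesHeegnerHypothesis p K)
    (ι : K →+* ℚ_[p]) (v vbar : HeightOneSpectrum (𝓞 K))
    (hv : ∀ x : 𝓞 K, x ∈ v.asIdeal ↔ ‖ι (x : K)‖ < 1)
    (hvbar : ((p : ℕ) : 𝓞 K) ∈ vbar.asIdeal) (hne : vbar ≠ v)
    (κ : ZpExtension K p) (hκ : κ.IsAnticyclotomic)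
    (γ : absoluteGaloisGroup K) [hγ : Fact (κ.IsTopGenerator γ)]
    (Dt : ModularParametrizationData W (W.conductorNorm ℤ)) (hc : ¬ (p : ℤ) ∣ Dt.c)
    (H : HeegnerDatum (W.conductorNorm ℤ) (NumberField.discr K)) (w : InfinitePlace K)
    (P : (W.baseChange K).toAffine.Point)
    (hP : WeierstrassCurve.Affine.Point.map w.embedding.toRatAlgHom P = heegnerPointComplex Dt H)
    (F : IwasawaAlgebra p)
    (hF : Literature.NumberTheory.EllipticCurves.Castella2018.AcSelmer.XAc.charIdeal
      (W.baseChange K) p κ vbar ∅ γ = Ideal.span {F}) :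
    ∃ e : ℤ_[p],
      ((PowerSeries.constantCoeff F : ℤ_[p]) : ℚ_[p]) =
        (e : ℚ_[p]) *
          ((1 - (W.frobeniusTrace p : ℚ_[p]) * (p : ℚ_[p])⁻¹ + (p : ℚ_[p])⁻¹) *
            padicLogOmega W p ι P) ^ 2 := by
  have hpp : p.Prime := Fact.out
  have hp2 : p ≠ 2 := by omega
  -- step 1: `p ∈ v`, the embedding datum `ι'` inducing `v`
  have hpv : ((p : ℕ) : 𝓞 K) ∈ v.asIdeal := natCast_mem_of_forall_mem_iff_norm_lt ι v hv
  obtain ⟨ι₀⟩ := PadicAlgCl.nonempty_ringEquiv_complex p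
  obtain ⟨ι', -, hι'⟩ := exists_datum_forall_mem_iff p ι₀ hK hpv
  have hsplit : ((Ideal.span {(p : ℤ)}).primesOver (𝓞 K)).ncard = 2 := hHp p hpp (dvd_refl p)
  have hsqN : Squarefree (W.conductorNorm ℤ) := squarefree_conductorNorm_of_semistable hsst
  have hiii' : Odd (W.conductorNorm ℤ) → ((Ideal.span {(2 : ℤ)}).primesOver (𝓞 K)).ncard = 2 :=
    fun hodd ↦ hiii hodd.not_two_dvd_nat
  have hgood : W.HasGoodReductionAtPrime p := hss.1
  have hpN : ¬ p ∣ W.conductorNorm ℤ := fun h ↦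
    (W.dvd_conductorNorm_iff_not_hasGoodReductionAtPrime p).mp h hgood
  have hpD : ¬ (p : ℤ) ∣ NumberField.discr K :=
    not_dvd_discr_of_ncard_primesOver hpp (by rw [hsplit, hK.1])
  -- step 2: Castella–Wan's frame and divisibility
  obtain ⟨ΩK, Ωp, LW, hΩK, hW, hincl⟩ :=
    h53 ι' W K v vbar κ γ Dt.isNewformOf hp hss hK hsplit hpv hι' hvbar hne hHeeg hκ hsqN hii hiii'
  -- step 3: Castella's frame and the value at 𝟙
  obtain ⟨ΩK', Ωp', LC, hΩK', hC, u, hu⟩ :=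
    h32 ι' W K v κ γ Dt H w ι P hp hsqN hirr hK hsplit hpv hι' hHeeg hκ hγ.out hc hP hv
  -- step 4: frame rigidity across the two normalisations
  have hΩp : ((Ωp : unrIntegers p) : ℂ_[p]) ≠ 0 := by
    rw [← norm_pos_iff, Halves.norm_coe_units_unrIntegers]; exact one_pos
  have hΩp' : ((Ωp' : unrIntegers p) : ℂ_[p]) ≠ 0 := by
    rw [← norm_pos_iff, Halves.norm_coe_units_unrIntegers]; exact one_pos
  have hD : (NumberField.discr K) ≠ 0 := NumberField.discr_ne_zero K
  have hnorm := norm_coe_constantCoeff_eq_of_isCWBDPLFunction_of_isBDPLFunction hp2 hK hκ hγ.out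
    hpN hpD hΩK hΩK' hΩp hΩp' hW hC
  -- the value of `L_C` at 𝟙
  set V : ℚ_[p] := ((1 : ℚ_[p]) - (W.LFunction p : ℚ_[p]) * (p : ℚ_[p])⁻¹ +
      (if p ∣ W.conductorNorm ℤ then 0 else (p : ℚ_[p])⁻¹)) * padicLogOmega W p ι P with hVdef
  have hLC0 : ((PowerSeries.constantCoeff LC : unrIntegers p) : ℂ_[p]) =
      ((u : unrIntegers p) : ℂ_[p]) * (algebraMap ℚ_[p] ℂ_[p] V) ^ 2 :=
    (UnrSeries.eq_constantCoeff_of_hasValueAt_zero hu).symm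
  have hnormC : ‖((PowerSeries.constantCoeff LC : unrIntegers p) : ℂ_[p])‖ = ‖V‖ ^ 2 := by
    rw [hLC0, norm_mul, Halves.norm_coe_units_unrIntegers, one_mul, norm_pow, norm_algebraMap']
  -- step 5: `j(F) = g · L_W`, norms
  obtain ⟨j, hj⟩ := exists_ringHom_padicInt_unrIntegers (p := p)
  have hle := hincl j hj
  rw [hF, Ideal.map_span, Set.image_singleton, Ideal.span_singleton_le_iff_mem,
    Ideal.mem_span_singleton'] at hle
  obtain ⟨g, hg⟩ := hle
  have hcoef : j (PowerSeries.constantCoeff F) =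
      PowerSeries.constantCoeff g * PowerSeries.constantCoeff LW := by
    have h := congrArg PowerSeries.constantCoeff hg
    have hm : PowerSeries.constantCoeff (PowerSeries.map j F) = j (PowerSeries.constantCoeff F) := by
      rw [← PowerSeries.coeff_zero_eq_constantCoeff_apply, PowerSeries.coeff_map,
        PowerSeries.coeff_zero_eq_constantCoeff_apply]
    rw [map_mul, hm] at h
    exact h.symm
  have hnormF : ‖((PowerSeries.constantCoeff F : ℤ_[p]) : ℚ_[p])‖ ≤ ‖V‖ ^ 2 := by
    have h1 : ‖algebraMap ℚ_[p] ℂ_[p] ((PowerSeries.constantCoeff F : ℤ_[p]) : ℚ_[p])‖ =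
        ‖((PowerSeries.constantCoeff F : ℤ_[p]) : ℚ_[p])‖ := norm_algebraMap' _ _
    rw [← h1, ← hj, hcoef, Subring.coe_mul, norm_mul, ← hnormC, ← hnorm]
    exact mul_le_of_le_one_left (norm_nonneg _) (Halves.norm_coe_unrIntegers_le_one p _)
  -- read `V` in the composite's letters: `ε_p = p⁻¹` (`p ∤ N`) and `a_p = frobeniusTrace`
  have hV : V = ((1 - (W.frobeniusTrace p : ℚ_[p]) * (p : ℚ_[p])⁻¹ + (p : ℚ_[p])⁻¹) *
      padicLogOmega W p ι P) := by
    rw [hVdef, if_neg hpN, WeierstrassCurve.LFunction_apply_prime_eq_frobeniusTrace W p hgood]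
  rw [hV] at hnormF
  exact exists_padicInt_mul_sq_of_norm_le hnormF

end Summit.BirchSwinnertonDyer.Rank1Residual.X11b

end
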